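import Mathlib
import Summits.ValiantsHypothesis.ValiantsHypothesis.Theorems.NewtonUnitEquationsDissociatedUniformGenericDefs

/-!
# Generic stratum of crux `DissociatedUniform` — words, top letters, demotions (abstract setting)

Crux stmt-ValiantsHypothesis-5905 (`NewtonUnitEquations.DissociatedUniform`), line `greedy-basis-shadow`, by-product
"generic stratum" (lead c5).  Abstract setting: coordinates `ι`, letters `L`, alphabets `A : ι → Finset L`, a letter
height `φ : L → ℝ`, words `a : ι → L` in the box `Fintype.piFinset A` with additive height `Hw φ a = Σ_j φ (a j)`.
This file: basic properties of the top letter `top`, the second letter `sec`, the best demotion weight `bestw`, the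
coordinate rank `crank`, the demoted set `dem`, the menu `U` and the letter rank `lrank` (all defined in `…GenericDefs`)
under injectivity of the word height on the box. [folklore]
-/

open scoped BigOperators

-- Sub = Summit single-conjunct layout: the duplicated namespace component is mandated by the tree.
set_option linter.dupNamespace false

namespace Summit.ValiantsHypothesis.ValiantsHypothesis.Theorems.NewtonUnitEquationsDissociatedUniform

namespace Generic

noncomputable section

variable {ι L : Type}

section Basic

variable (A : ι → Finset L) (φ : L → ℝ)

/-- The top letter of a nonempty alphabet lies in it. -/
theorem top_mem [Inhabited L] {j : ι} (hne : (A j).Nonempty) : top A φ j ∈ A j := by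
  unfold top; rw [dif_pos hne]; exact (Classical.choose_spec (Finset.exists_max_image (A j) φ hne)).1

/-- Every letter is at most the top letter. -/
theorem le_top [Inhabited L] {j : ι} {l : L} (hl : l ∈ A j) : φ l ≤ φ (top A φ j) := by
  have hne : (A j).Nonempty := ⟨l, hl⟩
  unfold top; rw [dif_pos hne]; exact (Classical.choose_spec (Finset.exists_max_image (A j) φ hne)).2 l hl

/-- On a big coordinate the second letter is a letter other than the top one. -/
theorem sec_mem_erase [Inhabited L] [DecidableEq L] {j : ι} (hb : ((A j).erase (top A φ j)).Nonempty) : sec A φ j ∈ (A j).erase (top A φ j) := by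
  have hb' : ((A j).erase (top A φ j)).Nonempty := hb
  unfold sec; rw [dif_pos hb']; exact (Classical.choose_spec (Finset.exists_max_image _ φ hb')).1

/-- On a big coordinate every non-top letter is at most the second letter. -/
theorem le_sec [Inhabited L] [DecidableEq L] {j : ι} (hb : ((A j).erase (top A φ j)).Nonempty) {l : L} (hl : l ∈ (A j).erase (top A φ j)) : φ l ≤ φ (sec A φ j) := by
  have hb' : ((A j).erase (top A φ j)).Nonempty := hb
  unfold sec; rw [dif_pos hb']; exact (Classical.choose_spec (Finset.exists_max_image _ φ hb')).2 l hl

/-- The second letter of a nonempty alphabet lies in it. -/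
theorem sec_mem [Inhabited L] [DecidableEq L] {j : ι} (hne : (A j).Nonempty) : sec A φ j ∈ A j := by
  by_cases hb : ((A j).erase (top A φ j)).Nonempty
  · exact Finset.mem_of_mem_erase (sec_mem_erase A φ hb)
  · have hb' : ¬ ((A j).erase (top A φ j)).Nonempty := hb
    unfold sec; rw [dif_neg hb']; exact top_mem A φ hne

/-- On a big coordinate the second letter is not the top letter. -/
theorem sec_ne_top [Inhabited L] [DecidableEq L] {j : ι} (hb : ((A j).erase (top A φ j)).Nonempty) : sec A φ j ≠ top A φ j :=
  Finset.ne_of_mem_erase (sec_mem_erase A φ hb)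

/-- Best demotion weights are nonnegative. -/
theorem bestw_nonneg [Inhabited L] [DecidableEq L] (j : ι) : 0 ≤ bestw A φ j := by
  unfold bestw
  by_cases hb : ((A j).erase (top A φ j)).Nonempty
  · exact sub_nonneg.mpr (le_top A φ (Finset.mem_of_mem_erase (sec_mem_erase A φ hb)))
  · have hb' : ¬ ((A j).erase (top A φ j)).Nonempty := hb
    unfold sec; rw [dif_neg hb']; simp

/-- A coordinate with a non-top letter is big. -/
theorem big_of_mem_ne [Inhabited L] [DecidableEq L] {j : ι} {l : L} (hl : l ∈ A j) (hne : l ≠ top A φ j) : ((A j).erase (top A φ j)).Nonempty :=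
  ⟨l, Finset.mem_erase.mpr ⟨hne, hl⟩⟩

/-- Unfolding membership in the demoted set. -/
theorem mem_dem [Fintype ι] [Inhabited L] [DecidableEq L] {a : ι → L} {j : ι} : j ∈ dem A φ a ↔ a j ≠ top A φ j := by
  simp [dem]

/-- Demoted coordinates of a word of the box are big. -/
theorem dem_subset_big [Fintype ι] [DecidableEq ι] [Inhabited L] [DecidableEq L] {a : ι → L} (ha : a ∈ Fintype.piFinset A) : ∀ j ∈ dem A φ a, ((A j).erase (top A φ j)).Nonempty :=
  fun j hj => big_of_mem_ne A φ (Fintype.mem_piFinset.mp ha j) ((mem_dem A φ).mp hj)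

/-- The height of an updated word. -/
theorem Hw_update [Fintype ι] [DecidableEq ι] (a : ι → L) (j : ι) (l : L) : Hw φ (Function.update a j l) = Hw φ a - φ (a j) + φ l := by
  unfold Hw
  have h1 : ∑ i, φ (Function.update a j l i) = ∑ i, Function.update (fun i => φ (a i)) j (φ l) i := by
    refine Finset.sum_congr rfl fun i _ => ?_
    by_cases hij : i = j
    · subst hij; simp
    · simp [Function.update_of_ne hij]
  rw [h1, Finset.sum_update_of_mem (Finset.mem_univ j)]
  have h2 : ∑ i, φ (a i) = φ (a j) + ∑ i ∈ Finset.univ \ {j}, φ (a i) := by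
    rw [← Finset.sum_erase_add _ _ (Finset.mem_univ j), Finset.sdiff_singleton_eq_erase]; ring
  rw [h2]; ring

/-- Updating a word of the box by a letter of the alphabet stays in the box. -/
theorem update_mem_box [Fintype ι] [DecidableEq ι] {a : ι → L} (ha : a ∈ Fintype.piFinset A) {j : ι} {l : L} (hl : l ∈ A j) :
    Function.update a j l ∈ Fintype.piFinset A := by
  refine Fintype.mem_piFinset.mpr fun i => ?_
  by_cases hij : i = j
  · subst hij; simpa using hl
  · rw [Function.update_of_ne hij]; exact Fintype.mem_piFinset.mp ha i

/-- Injectivity of the word height on the box makes `φ` injective on every alphabet (box nonempty). -/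
theorem phi_injOn [Fintype ι] [DecidableEq ι] (hinj : Set.InjOn (Hw φ) (Fintype.piFinset A : Set (ι → L))) {a₀ : ι → L}
    (ha₀ : a₀ ∈ Fintype.piFinset A) (j : ι) : Set.InjOn φ (A j : Set L) := by
  intro l hl l' hl' hll'
  have hl := Finset.mem_coe.mp hl
  have hl' := Finset.mem_coe.mp hl'
  have h := hinj (Finset.mem_coe.mpr (update_mem_box A ha₀ hl)) (Finset.mem_coe.mpr (update_mem_box A ha₀ hl'))
    (by rw [Hw_update, Hw_update, hll'])
  have := congrFun h j
  simpa using this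

variable {A φ}

/-- Under injectivity the top letter is a strict maximum. -/
theorem lt_top [Inhabited L] (hφ : ∀ j, Set.InjOn φ (A j : Set L)) {j : ι} {l : L} (hl : l ∈ A j) (hne : l ≠ top A φ j) :
    φ l < φ (top A φ j) :=
  lt_of_le_of_ne (le_top A φ hl) fun h => hne (hφ j (Finset.mem_coe.mpr hl) (Finset.mem_coe.mpr (top_mem A φ ⟨l, hl⟩)) h)

/-- Under injectivity the second letter is strictly below the top letter on a big coordinate. -/
theorem bestw_pos [Inhabited L] [DecidableEq L] (hφ : ∀ j, Set.InjOn φ (A j : Set L)) {j : ι} (hb : ((A j).erase (top A φ j)).Nonempty) : 0 < bestw A φ j := by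
  unfold bestw
  have h := sec_mem_erase A φ hb
  exact sub_pos.mpr (lt_top hφ (Finset.mem_of_mem_erase h) (Finset.ne_of_mem_erase h))

/-- A non-top letter weighs at least the best demotion weight. -/
theorem bestw_le_weight [Inhabited L] [DecidableEq L] {j : ι} {l : L} (hl : l ∈ A j) (hne : l ≠ top A φ j) :
    bestw A φ j ≤ φ (top A φ j) - φ l := by
  unfold bestw
  have hb := big_of_mem_ne A φ hl hne
  have := le_sec A φ hb (Finset.mem_erase.mpr ⟨hne, hl⟩)
  linarith

/-- The menu `U` has `lrank + 1` letters (under injectivity). -/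
theorem card_U [DecidableEq L] (hφ : ∀ j, Set.InjOn φ (A j : Set L)) {a : ι → L} {j : ι} (ha : a j ∈ A j) :
    (U A φ a j).card = lrank A φ a j + 1 := by
  unfold U lrank
  have hsplit : (A j).filter (fun l => φ (a j) ≤ φ l) = insert (a j) ((A j).filter fun l => φ (a j) < φ l) := by
    ext l
    simp only [Finset.mem_filter, Finset.mem_insert]
    constructor
    · rintro ⟨hl, hle⟩
      rcases hle.lt_or_eq with hlt | heq
      · exact Or.inr ⟨hl, hlt⟩
      · exact Or.inl (hφ j (Finset.mem_coe.mpr hl) (Finset.mem_coe.mpr ha) heq.symm)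
    · rintro (rfl | ⟨hl, hlt⟩)
      · exact ⟨ha, le_rfl⟩
      · exact ⟨hl, hlt.le⟩
  rw [hsplit, Finset.card_insert_of_notMem]
  simp

/-- On a demoted coordinate the letter rank is positive (the top letter is strictly higher). -/
theorem one_le_lrank [Fintype ι] [Inhabited L] [DecidableEq L] (hφ : ∀ j, Set.InjOn φ (A j : Set L)) {a : ι → L} {j : ι} (ha : a j ∈ A j)
    (hj : j ∈ dem A φ a) : 1 ≤ lrank A φ a j := by
  unfold lrank
  refine Finset.card_pos.mpr ⟨top A φ j, Finset.mem_filter.mpr ⟨top_mem A φ ⟨_, ha⟩, ?_⟩⟩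
  exact lt_top hφ ha ((mem_dem A φ).mp hj)

/-- The letter rank determines the letter (under injectivity). -/
theorem eq_of_lrank_eq (hφ : ∀ j, Set.InjOn φ (A j : Set L)) {a a' : ι → L} {j : ι} (ha : a j ∈ A j)
    (ha' : a' j ∈ A j) (h : lrank A φ a j = lrank A φ a' j) : a j = a' j := by
  by_contra hne
  have hne' : φ (a j) ≠ φ (a' j) := fun h' => hne (hφ j (Finset.mem_coe.mpr ha) (Finset.mem_coe.mpr ha') h')
  -- WLOG by symmetry: the strictly lower letter has strictly larger rank
  have key : ∀ b b' : ι → L, b j ∈ A j → b' j ∈ A j → φ (b j) < φ (b' j) → lrank A φ b' j < lrank A φ b j := by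
    intro b b' hb hb' hlt
    unfold lrank
    refine Finset.card_lt_card ((Finset.ssubset_iff_of_subset ?_).mpr ⟨b' j, ?_, ?_⟩)
    · intro l hl
      rw [Finset.mem_filter] at hl ⊢
      exact ⟨hl.1, hlt.trans hl.2⟩
    · exact Finset.mem_filter.mpr ⟨hb', hlt⟩
    · simp
  rcases lt_or_gt_of_ne hne' with hlt | hgt
  · exact absurd h (key a a' ha ha' hlt).ne'
  · exact absurd h (key a' a ha' ha hgt).ne

/-- Best demotion weights are pairwise distinct on big coordinates (under injectivity of the word height). -/
theorem bestw_injOn_big [Fintype ι] [DecidableEq ι] [Inhabited L] [DecidableEq L] (hinj : Set.InjOn (Hw φ) (Fintype.piFinset A : Set (ι → L))) (hne : ∀ j, (A j).Nonempty)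
    {c j : ι} (hc : ((A c).erase (top A φ c)).Nonempty) (h : bestw A φ c = bestw A φ j) : c = j := by
  by_contra hcj
  set τ : ι → L := fun i => top A φ i with hτ
  have hτmem : τ ∈ Fintype.piFinset A := Fintype.mem_piFinset.mpr fun i => top_mem A φ (hne i)
  have h1 := update_mem_box A hτmem (sec_mem A φ (hne c) : sec A φ c ∈ A c)
  have h2 := update_mem_box A hτmem (sec_mem A φ (hne j) : sec A φ j ∈ A j)
  have heq : Hw φ (Function.update τ c (sec A φ c)) = Hw φ (Function.update τ j (sec A φ j)) := by
    rw [Hw_update, Hw_update]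
    unfold bestw at h
    simp only [hτ] at h ⊢
    linarith
  have h := hinj (Finset.mem_coe.mpr h1) (Finset.mem_coe.mpr h2) heq
  have := congrFun h c
  rw [Function.update_self, Function.update_of_ne hcj] at this
  exact sec_ne_top A φ hc this

/-- The coordinate rank is strictly monotone in the best demotion weight (for a big source). -/
theorem crank_lt_crank [Fintype ι] [Inhabited L] [DecidableEq L] {c j : ι} (hc : ((A c).erase (top A φ c)).Nonempty) (h : bestw A φ c < bestw A φ j) : crank A φ c < crank A φ j := by
  unfold crank
  refine Finset.card_lt_card ((Finset.ssubset_iff_of_subset ?_).mpr ⟨c, ?_, ?_⟩)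
  · intro x hx
    rw [Finset.mem_filter] at hx ⊢
    exact ⟨hx.1, hx.2.1, hx.2.2.trans h⟩
  · exact Finset.mem_filter.mpr ⟨Finset.mem_univ _, hc, h⟩
  · simp

/-- The coordinate rank is injective on big coordinates (under injectivity of the word height). -/
theorem crank_injOn_big [Fintype ι] [DecidableEq ι] [Inhabited L] [DecidableEq L] (hinj : Set.InjOn (Hw φ) (Fintype.piFinset A : Set (ι → L))) (hne : ∀ j, (A j).Nonempty)
    {c j : ι} (hc : ((A c).erase (top A φ c)).Nonempty) (hj : ((A j).erase (top A φ j)).Nonempty) (h : crank A φ c = crank A φ j) : c = j := by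
  by_contra hcj
  have hne' : bestw A φ c ≠ bestw A φ j := fun h' => hcj (bestw_injOn_big hinj hne hc h')
  rcases lt_or_gt_of_ne hne' with hlt | hgt
  · exact absurd h (crank_lt_crank hc hlt).ne
  · exact absurd h (crank_lt_crank hj hgt).ne'

/-- For big coordinates, comparing ranks is comparing best demotion weights. -/
theorem crank_lt_crank_iff [Fintype ι] [DecidableEq ι] [Inhabited L] [DecidableEq L] (hinj : Set.InjOn (Hw φ) (Fintype.piFinset A : Set (ι → L))) (hne : ∀ j, (A j).Nonempty)
    {c j : ι} (hc : ((A c).erase (top A φ c)).Nonempty) (hj : ((A j).erase (top A φ j)).Nonempty) : crank A φ c < crank A φ j ↔ bestw A φ c < bestw A φ j := by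
  constructor
  · intro h
    by_contra hle
    rcases (not_lt.mp hle).lt_or_eq with hlt | heq
    · exact absurd h (not_lt.mpr (crank_lt_crank hj hlt).le)
    · exact absurd h (by rw [bestw_injOn_big hinj hne hj heq]; exact lt_irrefl _)
  · exact crank_lt_crank hc

end Basic

end

end Generic

/-- **Registered sub-goal (file `GenericWords`).**  Under injectivity of the word height on the box, the coordinate
rank is injective on big coordinates. -/
theorem generic_crank_injOn_big {ι L : Type} [Fintype ι] [DecidableEq ι] [Inhabited L] [DecidableEq L] (A : ι → Finset L) (φ : L → ℝ) (hinj : Set.InjOn (Generic.Hw φ) (Fintype.piFinset A : Set (ι → L))) (hne : ∀ j, (A j).Nonempty) {c j : ι} (hc : ((A c).erase (Generic.top A φ c)).Nonempty) (hj : ((A j).erase (Generic.top A φ j)).Nonempty) (h : Generic.crank A φ c = Generic.crank A φ j) : c = j :=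
  Generic.crank_injOn_big hinj hne hc hj h

end Summit.ValiantsHypothesis.ValiantsHypothesis.Theorems.NewtonUnitEquationsDissociatedUniform
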